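import Summits.QuantumFields.YangMills.Theses.FemtoCutoffLadder
import Summits.QuantumFields.YangMills.Theorems.FemtoTransferGapBounds
import Summits.QuantumFields.YangMills.Theorems.FemtoCutoffLadderLargeFieldInsensitivityTopPos

/-!
# FemtoCutoffLadder — the local wall line glues: `LocalWallStep → LargeFieldInsensitivityR`

Route `FemtoCutoffLadder` (D-0145 LINE g5-A of seat ym-idea-1, technique «restrict-then-tighten»; bears on the
R2b1 record rung `FemtoGapOfRecord` through `LargeFieldInsensitivityR → (with SmallFieldOctaveStep) OctaveStepDecay`).

`LocalWallStep` (stmt-QuantumFields-26282) restricts the large-field surgery to ONE plaquette: adding the Dirichlet wall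
"ψ vanishes on configurations with a κ-bad plaquette at p₀" on top of an arbitrary wall set `Q` moves the compressed pair
`(s Q, t Q)` (walled first-excited minimax value, walled top Rayleigh value) by at most the factor `exp(A/(β²N))`,
`N = #Plaquette 3 L`, in the cross-multiplied `L`-th-power sense.  This file is the TIGHTEN step, pure bookkeeping:
telescoping over an enumeration of all plaquettes (`LocalWall.telescope`, a `Finset` induction) gives
`LargeFieldInsensitivityR` (stmt-QuantumFields-26197) with `C = 0`; the empty wall set returns `topValue`/`secondValue`
definitionally and the full wall set is the `SF_κ` predicate of B′.  No summit is proved by this file.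
-/

set_option autoImplicit false

noncomputable section


namespace Summit.QuantumFields.YangMills.Theorems.FemtoCutoffLadder

open Summit.QuantumFields.YangMills.Theorems.FemtoTransferGap
open Summit.QuantumFields.YangMills.Theses.FemtoCutoffLadder
open Literature.MathematicalPhysics.QuantumFieldTheory (GaugeConfig Plaquette plaquetteHolonomy)

/-- **Telescoping over wall sets** (pure bookkeeping): if adding one element to any wall set changes the pair `(s, t)` of
compressed values by at most the factor `e^x` in the cross-multiplied sense (with `t > 0` throughout), then for every finite wall set
`F` the pair `(s F, t F)` is within `e^{|F|·x}` of `(s ∅, t ∅)`. [folklore] -/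
theorem LocalWall.telescope {ι : Type*} (t s : Set ι → ℝ) (L : ℕ) (x : ℝ) (h0 : 0 < t ∅)
    (hstep : ∀ (Q : Set ι) (p₀ : ι), p₀ ∉ Q → 0 < t Q ∧ 0 < t (insert p₀ Q) ∧
      s (insert p₀ Q) ^ L * t Q ^ L ≤ Real.exp x * (s Q ^ L * t (insert p₀ Q) ^ L) ∧
      s Q ^ L * t (insert p₀ Q) ^ L ≤ Real.exp x * (s (insert p₀ Q) ^ L * t Q ^ L))
    (F : Finset ι) :
    0 < t ↑F ∧ s ↑F ^ L * t ∅ ^ L ≤ Real.exp (F.card * x) * (s ∅ ^ L * t ↑F ^ L) ∧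
      s ∅ ^ L * t ↑F ^ L ≤ Real.exp (F.card * x) * (s ↑F ^ L * t ∅ ^ L) := by
  classical
  induction F using Finset.induction_on with
  | empty => simp [h0]
  | insert p₀ F hp ih =>
    obtain ⟨hTF, ih1, ih2⟩ := ih
    have hp' : p₀ ∉ (↑F : Set ι) := by simpa using hp
    obtain ⟨-, hTF', h1, h2⟩ := hstep (↑F) p₀ hp'
    rw [Finset.coe_insert]
    refine ⟨hTF', ?_, ?_⟩
    · rw [Finset.card_insert_of_notMem hp]
      push_cast
      rw [add_mul, one_mul, Real.exp_add]
      -- abbreviations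
      set a := s ↑F ^ L
      set b := t ↑F ^ L
      set a' := s (insert p₀ (↑F : Set ι)) ^ L
      set b' := t (insert p₀ (↑F : Set ι)) ^ L
      set a0 := s (∅ : Set ι) ^ L
      set b0 := t (∅ : Set ι) ^ L
      set E := Real.exp (F.card * x)
      set e := Real.exp x
      have hb : 0 < b := pow_pos hTF _
      have hb' : 0 ≤ b' := (pow_pos hTF' _).le
      have hb0 : 0 ≤ b0 := (pow_pos h0 _).le
      have hE : 0 ≤ E := (Real.exp_pos _).le
      have he : 0 ≤ e := (Real.exp_pos _).le
      have key : a' * b0 * b ≤ E * e * (a0 * b') * b := by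
        calc a' * b0 * b = (a' * b) * b0 := by ring
          _ ≤ (e * (a * b')) * b0 := mul_le_mul_of_nonneg_right h1 hb0
          _ = e * b' * (a * b0) := by ring
          _ ≤ e * b' * (E * (a0 * b)) := mul_le_mul_of_nonneg_left ih1 (mul_nonneg he hb')
          _ = E * e * (a0 * b') * b := by ring
      exact le_of_mul_le_mul_right key hb
    · rw [Finset.card_insert_of_notMem hp]
      push_cast
      rw [add_mul, one_mul, Real.exp_add]
      set a := s ↑F ^ L
      set b := t ↑F ^ L
      set a' := s (insert p₀ (↑F : Set ι)) ^ L
      set b' := t (insert p₀ (↑F : Set ι)) ^ L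
      set a0 := s (∅ : Set ι) ^ L
      set b0 := t (∅ : Set ι) ^ L
      set E := Real.exp (F.card * x)
      set e := Real.exp x
      have hb : 0 < b := pow_pos hTF _
      have hb' : 0 ≤ b' := (pow_pos hTF' _).le
      have hb0 : 0 ≤ b0 := (pow_pos h0 _).le
      have hE : 0 ≤ E := (Real.exp_pos _).le
      have he : 0 ≤ e := (Real.exp_pos _).le
      have key : a0 * b' * b ≤ E * e * (a' * b0) * b := by
        calc a0 * b' * b = (a0 * b) * b' := by ring
          _ ≤ (E * (a * b0)) * b' := mul_le_mul_of_nonneg_right ih2 hb'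
          _ = E * b0 * (a * b') := by ring
          _ ≤ E * b0 * (e * (a' * b)) := mul_le_mul_of_nonneg_left h2 (mul_nonneg hE hb0)
          _ = E * e * (a' * b0) * b := by ring
      exact le_of_mul_le_mul_right key hb

/-- ★ **The local wall line glues**: `LocalWallStep → LargeFieldInsensitivityR` (with `C = 0`): wall the `3L³` spatial plaquettes one at a
time; each step costs at most the factor `exp(A/(β²N))`, `N = #plaquettes`, so the fully walled (= `SF_κ`-compressed) pair `(s_κ, t_κ)` is
within `exp(A/β²)` of `(λ₁, λ₀)` in the cross-multiplied sense; the empty wall set gives back `topValue` / `secondValue` by definition.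
[cite: ReedSimonIV1978, Thm. XIII.1] -/
theorem largeFieldInsensitivityR_of_localWallStep (h : LocalWallStep) : LargeFieldInsensitivityR := by
  intro κ σ hκ hκ1 hσ
  obtain ⟨A, lam0, L0, hA, hlam0, H⟩ := h κ hκ hκ1
  refine ⟨0, A, lam0, L0, le_rfl, hA, hlam0, ?_⟩
  intro lam hlam hle L _ hL β hW
  -- name the pieces
  set bad : GaugeConfig 3 L SU2 → Plaquette 3 L → Prop := fun U p =>
    β ^ (κ - 1) < 2 - (su2Rep (plaquetteHolonomy U p.1 p.2.1.1 p.2.1.2)).trace.re with hbad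
  set W : Set (Plaquette 3 L) → (GaugeConfig 3 L SU2 → ℝ) → Prop := fun Q ψ => ∀ U, (∃ p ∈ Q, bad U p) → ψ U = 0 with hWdef
  set t : Set (Plaquette 3 L) → ℝ := fun Q => sSup (rayleighSet su2Rep L β (W Q)) with htdef
  set s : Set (Plaquette 3 L) → ℝ := fun Q => sInf {x : ℝ | ∃ φ : GaugeConfig 3 L SU2 → ℝ, IsPhys φ ∧
    x = sSup (rayleighSet su2Rep L β fun ψ => W Q ψ ∧ l2 ψ φ = 0)} with hsdef
  set N : ℝ := (Fintype.card (Plaquette 3 L) : ℝ) with hN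
  have hstep : ∀ (Q : Set (Plaquette 3 L)) (p₀ : Plaquette 3 L), p₀ ∉ Q → 0 < t Q ∧ 0 < t (insert p₀ Q) ∧
      s (insert p₀ Q) ^ L * t Q ^ L ≤ Real.exp (A / β ^ 2 / N) * (s Q ^ L * t (insert p₀ Q) ^ L) ∧
      s Q ^ L * t (insert p₀ Q) ^ L ≤ Real.exp (A / β ^ 2 / N) * (s (insert p₀ Q) ^ L * t Q ^ L) :=
    H lam hlam hle L hL β hW
  have p1 : Plaquette 3 L := ((fun _ => 0), ⟨((0 : Fin 3), (1 : Fin 3)), by decide⟩)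
  have h0 : 0 < t ∅ := (hstep ∅ p1 (fun h => h)).1
  obtain ⟨htu, h1, h2⟩ := LocalWall.telescope t s L (A / β ^ 2 / N) h0 hstep Finset.univ
  rw [Finset.coe_univ] at htu h1 h2
  rw [Finset.card_univ] at h1 h2
  -- the exponent: `N · (A/(β²N)) = 0·Λ²/L^σ + A/β²`
  have hNpos : 0 < N := by
    rw [hN]; exact_mod_cast (Fintype.card_pos_iff.mpr ⟨p1⟩)
  have hexp : (Fintype.card (Plaquette 3 L) : ℝ) * (A / β ^ 2 / N) =
      0 * luscherLambda β L ^ 2 / (L : ℝ) ^ σ + A / β ^ 2 := by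
    rw [zero_mul, zero_div, zero_add, ← hN]; field_simp
  rw [hexp] at h1 h2
  -- the empty wall set gives `topValue` / `secondValue`, the full one the `SF_κ` predicate
  have hWe : W ∅ = fun _ => True := by
    funext ψ; simp [hWdef]
  have hWu : W Set.univ = fun ψ => ∀ U, (∃ p : Plaquette 3 L, bad U p) → ψ U = 0 := by
    funext ψ; simp [hWdef]
  have ht0 : t ∅ = topValue su2Rep L β := by
    show sSup (rayleighSet su2Rep L β (W ∅)) = _; rw [hWe]; rfl
  have hs0 : s ∅ = secondValue su2Rep L β := by
    show sInf {x : ℝ | ∃ φ : GaugeConfig 3 L SU2 → ℝ, IsPhys φ ∧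
      x = sSup (rayleighSet su2Rep L β fun ψ => W ∅ ψ ∧ l2 ψ φ = 0)} = _
    rw [hWe]; simp only [true_and]; rfl
  have htu' : t Set.univ = sSup (rayleighSet su2Rep L β fun ψ => ∀ U, (∃ p : Plaquette 3 L, bad U p) → ψ U = 0) := by
    show sSup (rayleighSet su2Rep L β (W Set.univ)) = _; rw [hWu]
  have hsu' : s Set.univ = sInf {x : ℝ | ∃ φ : GaugeConfig 3 L SU2 → ℝ, IsPhys φ ∧
      x = sSup (rayleighSet su2Rep L β fun ψ => (∀ U, (∃ p : Plaquette 3 L, bad U p) → ψ U = 0) ∧ l2 ψ φ = 0)} := by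
    show sInf {x : ℝ | ∃ φ : GaugeConfig 3 L SU2 → ℝ, IsPhys φ ∧
      x = sSup (rayleighSet su2Rep L β fun ψ => W Set.univ ψ ∧ l2 ψ φ = 0)} = _
    rw [hWu]
  rw [ht0, hs0, htu', hsu'] at h1 h2
  rw [htu'] at htu
  simp only [hbad] at htu h1 h2
  dsimp only
  exact ⟨htu, h2, h1⟩

end Summit.QuantumFields.YangMills.Theorems.FemtoCutoffLadder

end
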